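import Literature.NumberTheory.Transcendental.RoySmallValueAnalytic
import Literature.NumberTheory.Transcendental.RoySmallValueVanishing
import HarnessLib

/-!
# Roy's small value estimate for `𝔾ₐ × 𝔾ₘ` — §4 Distance: Lemma 4.1, Proposition 4.2, Corollary 4.3

Topic `Literature/NumberTheory/Transcendental`. Part of the formalisation of the proof of Roy 2013,
Theorem 1.1 (named fact `roy2013_thm_1_1`, `RoySmallValueEstimates.lean`). Source: D. Roy,
*A small value estimate for `𝔾ₐ × 𝔾ₘ`*, Mathematika 59 (2013) 333–363 = arXiv:1301.0663, §4
(pp. 11–12 of the arXiv text).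

For `γ = (ξ, η)`, `c₂ = max{1, |ξ|, |η|} = ‖(1, γ)‖`, and a point `α ∈ ℙ²(ℂ)` with representative
`(α₀, α₁, α₂)` of sup norm `1`, Roy uses the projective distance (his (4.1))
`dist(α, (1:γ)) = c₂⁻¹ max{|α₁ - α₀ξ|, |α₂ - α₀η|, |α₁η - α₂ξ|}` — `pdist ξ η α` — and the
distance to the analytic curve `A_γ = {(1 : ξ+z : ηe^z)}`,
`dist(α, A_γ) = |α₂/α₀ - η exp(α₁/α₀ - ξ)|` — `adist ξ η α`.

* `lemma_4_1` — **Lemma 4.1**: `dist(α, (1:γ)) ≤ (2c₂)⁻¹` forces `|α₀| ≥ (2c₂)⁻¹`.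
* `prop_4_2` — **Proposition 4.2** in the form
  `|P(α)| ≤ e^{2c₂²} max_{i<T} |𝒟ⁱP(1, γ)| + 𝓛(P) c₄^D (dist(α,(1:γ))^T + dist(α, A_γ))` for
  `P ∈ ℂ[X]_D` (Roy: `|P(α)|/‖P‖ ≤ c₄ max |𝒟ⁱP(1,γ)|/‖P‖ + c₄^D(…)`, `c₄ = 3c₂e^{2c₂²}`; our
  `c₄ = roy_c4 ξ η` is another explicit constant depending only on `γ`, and `𝓛(P) ≤ 3^D ‖P‖`;
  only the shape matters in Step 4 of §7). The proof is the printed one: `f(z) = P(1, ξ+z, ηe^z)`,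
  `f^{(i)}(0) = 𝒟ⁱP(1, γ)` (`RoySmallValueAnalytic.lean`), Taylor expansion at `δ₁ = α₁/α₀ - ξ`
  split at `i = T`, homogeneity `α₀^D f(δ₁) = P(α₀, α₁, α₂ - δ₂α₀)`, and a Lipschitz bound for
  the last coordinate.
* `cor_4_3` — **Corollary 4.3**: for `P ∈ I_D^{(γ,T)}`,
  `|P(α)| ≤ (3c₄)^D ‖P‖ (dist(α,(1:γ))^T + dist(α, A_γ))`, i.e. the printed
  `|I_D^{(γ,T)}|_α ≤ c₄^D (dist^T + dist_A)` tested on each `P` of norm `≤ 1`.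

Definitions: `roy_c2`, `roy_c4`, `pdist`, `adist`. Everything is proved; no new named facts.

## References

* [Roy2013] D. Roy, *A small value estimate for 𝔾ₐ × 𝔾ₘ*, Mathematika 59 (2013), 333–363
  (arXiv:1301.0663), §4, (4.1), Lemma 4.1, Proposition 4.2, Corollary 4.3.
-/

noncomputable section

open MvPolynomial Finset Complex

namespace Literature.NumberTheory.Transcendental

namespace Roy2013

open Nesterenko

/-! ### Constants and distances -/

/-- Roy's `c₂(γ) = max{1, |ξ|, |η|} = ‖(1, ξ, η)‖`. [cite: Roy2013, Lemma 3.1 and §4 (p. 11)] -/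
def roy_c2 (ξ η : ℂ) : ℝ := max 1 (max ‖ξ‖ ‖η‖)

/-- `c₂ ≥ 1`. [cite: Roy2013, §4 (p. 11)] -/
theorem one_le_roy_c2 (ξ η : ℂ) : 1 ≤ roy_c2 ξ η := le_max_left _ _

/-- `|ξ| ≤ c₂`. [cite: Roy2013, §4 (p. 11)] -/
theorem norm_le_roy_c2_left (ξ η : ℂ) : ‖ξ‖ ≤ roy_c2 ξ η :=
  (le_max_left _ _).trans (le_max_right _ _)

/-- `|η| ≤ c₂`. [cite: Roy2013, §4 (p. 11)] -/
theorem norm_le_roy_c2_right (ξ η : ℂ) : ‖η‖ ≤ roy_c2 ξ η :=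
  (le_max_right _ _).trans (le_max_right _ _)

/-- The auxiliary bound `A(γ) = 2c₂ + c₂e^{c₂} + 1` for the coordinates of the perturbed point in
the proof of Proposition 4.2 (Roy: `3 + |δ₂α₀| ≤ 4 + |η|e^{|δ₁|} ≤ 4 + c₂e^{c₂}`). [folklore] -/
def roy_A (ξ η : ℂ) : ℝ := 2 * roy_c2 ξ η + roy_c2 ξ η * Real.exp (roy_c2 ξ η) + 1

/-- Our version of Roy's constant `c₄(γ)`: `c₄ = c₂ e^{2c₂²} + 2A(γ)` (Roy: `c₄ = 3c₂e^{2c₂²}`; any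
explicit constant depending only on `γ` serves in §7). [cite: Roy2013, Proposition 4.2] -/
def roy_c4 (ξ η : ℂ) : ℝ := roy_c2 ξ η * Real.exp (2 * roy_c2 ξ η ^ 2) + 2 * roy_A ξ η

/-- **Roy's (4.1)**: the projective distance between `α = (α₀:α₁:α₂)` (representative of sup
norm `1`) and `(1:γ) = (1:ξ:η)`: `dist(α,(1:γ)) = c₂⁻¹ max{|α₁-α₀ξ|, |α₂-α₀η|, |α₁η-α₂ξ|}`.
[cite: Roy2013, §4, (4.1)] -/
def pdist (ξ η : ℂ) (α : Fin 3 → ℂ) : ℝ :=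
  max (max ‖α 1 - α 0 * ξ‖ ‖α 2 - α 0 * η‖) ‖α 1 * η - α 2 * ξ‖ / roy_c2 ξ η

/-- The distance from `α` to the analytic curve `A_γ = {(1 : ξ+z : ηe^z) ; z ∈ ℂ}`:
`dist(α, A_γ) = |α₂/α₀ - η exp(α₁/α₀ - ξ)|` (for `α₀ ≠ 0`). [cite: Roy2013, §4 (p. 11)] -/
def adist (ξ η : ℂ) (α : Fin 3 → ℂ) : ℝ := ‖α 2 / α 0 - η * cexp (α 1 / α 0 - ξ)‖

/-- `dist(α,(1:γ)) ≥ 0`. [folklore] -/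
theorem pdist_nonneg (ξ η : ℂ) (α : Fin 3 → ℂ) : 0 ≤ pdist ξ η α :=
  div_nonneg (le_trans (norm_nonneg _) (le_max_right _ _))
    (zero_le_one.trans (one_le_roy_c2 ξ η))

/-- `dist(α, A_γ) ≥ 0`. [folklore] -/
theorem adist_nonneg (ξ η : ℂ) (α : Fin 3 → ℂ) : 0 ≤ adist ξ η α := norm_nonneg _

/-- `|α₁ - α₀ξ| ≤ c₂ dist(α,(1:γ))`. [cite: Roy2013, §4, (4.1)] -/
theorem norm_sub_xi_le_pdist (ξ η : ℂ) (α : Fin 3 → ℂ) :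
    ‖α 1 - α 0 * ξ‖ ≤ roy_c2 ξ η * pdist ξ η α := by
  rw [pdist, mul_div_cancel₀ _ (ne_of_gt (lt_of_lt_of_le one_pos (one_le_roy_c2 ξ η)))]
  exact (le_max_left _ _).trans (le_max_left _ _)

/-- `|α₂ - α₀η| ≤ c₂ dist(α,(1:γ))`. [cite: Roy2013, §4, (4.1)] -/
theorem norm_sub_eta_le_pdist (ξ η : ℂ) (α : Fin 3 → ℂ) :
    ‖α 2 - α 0 * η‖ ≤ roy_c2 ξ η * pdist ξ η α := by
  rw [pdist, mul_div_cancel₀ _ (ne_of_gt (lt_of_lt_of_le one_pos (one_le_roy_c2 ξ η)))]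
  exact (le_max_right _ _).trans (le_max_left _ _)

/-! ### Lemma 4.1 -/

/-- **Roy 2013, Lemma 4.1**: if `α` has a representative of sup norm `1` (all `|αᵢ| ≤ 1`, some
`|αᵢ| = 1`) and `dist(α, (1:γ)) ≤ (2c₂)⁻¹`, then `|α₀| ≥ (2c₂)⁻¹`. [cite: Roy2013, Lemma 4.1] -/
theorem lemma_4_1 {ξ η : ℂ} {α : Fin 3 → ℂ} (hα1 : ∃ i, 1 ≤ ‖α i‖)
    (hd : pdist ξ η α ≤ (2 * roy_c2 ξ η)⁻¹) : (2 * roy_c2 ξ η)⁻¹ ≤ ‖α 0‖ := by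
  have hc := one_le_roy_c2 ξ η
  have hc0 : 0 < roy_c2 ξ η := by linarith
  have hm : roy_c2 ξ η * pdist ξ η α ≤ 1 / 2 := by
    calc roy_c2 ξ η * pdist ξ η α ≤ roy_c2 ξ η * (2 * roy_c2 ξ η)⁻¹ :=
          mul_le_mul_of_nonneg_left hd hc0.le
      _ = 1 / 2 := by field_simp
  have hinv : (2 * roy_c2 ξ η)⁻¹ ≤ 1 / 2 := by
    rw [inv_le_comm₀ (by positivity) (by norm_num)]
    linarith
  obtain ⟨i, hi⟩ := hα1
  fin_cases i
  · have h1 : (1 : ℝ) ≤ ‖α 0‖ := by simpa using hi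
    linarith
  · -- `|α₁| = 1`: `|α₀| |ξ| ≥ 1 - |α₁ - α₀ξ| ≥ 1/2`
    have h1 : (1 : ℝ) ≤ ‖α 1‖ := by simpa using hi
    have h2 : ‖α 1‖ ≤ ‖α 1 - α 0 * ξ‖ + ‖α 0‖ * ‖ξ‖ := by
      rw [← norm_mul]; exact norm_le_norm_sub_add _ _
    have h3 := norm_sub_xi_le_pdist ξ η α
    have h4 : ‖α 0‖ * ‖ξ‖ ≤ ‖α 0‖ * roy_c2 ξ η :=
      mul_le_mul_of_nonneg_left (norm_le_roy_c2_left ξ η) (norm_nonneg _)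
    rw [inv_le_iff_one_le_mul₀ (by positivity)]
    nlinarith
  · have h1 : (1 : ℝ) ≤ ‖α 2‖ := by simpa using hi
    have h2 : ‖α 2‖ ≤ ‖α 2 - α 0 * η‖ + ‖α 0‖ * ‖η‖ := by
      rw [← norm_mul]; exact norm_le_norm_sub_add _ _
    have h3 := norm_sub_eta_le_pdist ξ η α
    have h4 : ‖α 0‖ * ‖η‖ ≤ ‖α 0‖ * roy_c2 ξ η :=
      mul_le_mul_of_nonneg_left (norm_le_roy_c2_right ξ η) (norm_nonneg _)
    rw [inv_le_iff_one_le_mul₀ (by positivity)]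
    nlinarith

/-! ### Proposition 4.2 -/

/-- **Roy 2013, Proposition 4.2** (values near `(1:γ)`): let `P ∈ ℂ[X]_D`, `T ∈ ℕ`, and `α` with
all `|αᵢ| ≤ 1`, `|α₀| ≥ (2c₂)⁻¹` and `dist(α,(1:γ)) ≤ (2c₂)⁻¹` (the situation of Lemma 4.1). If
`|𝒟ⁱP(1, γ)| ≤ B` for all `i < T`, then
`|P(α)| ≤ e^{2c₂²} B + 𝓛(P) c₄^D (dist(α,(1:γ))^T + dist(α, A_γ))`.
(Roy: `|P(α)|/‖P‖ ≤ c₄ max_{i<T} |𝒟ⁱP(1,γ)|/‖P‖ + c₄^D (dist^T + dist_A)`, `c₄ = 3c₂e^{2c₂²}`.)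
[cite: Roy2013, Proposition 4.2] -/
theorem prop_4_2 {ξ η : ℂ} {D T : ℕ} {P : CX} (hP : P.IsHomogeneous D) {α : Fin 3 → ℂ}
    (hα : ∀ i, ‖α i‖ ≤ 1) (hα0 : (2 * roy_c2 ξ η)⁻¹ ≤ ‖α 0‖)
    (hd : pdist ξ η α ≤ (2 * roy_c2 ξ η)⁻¹) {B : ℝ} (hB0 : 0 ≤ B)
    (hB : ∀ n < T, ‖aeval ![1, ξ, η] (homD^[n] P)‖ ≤ B) :
    ‖aeval α P‖ ≤ Real.exp (2 * roy_c2 ξ η ^ 2) * B +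
      l1Norm P * roy_c4 ξ η ^ D * (pdist ξ η α ^ T + adist ξ η α) := by
  -- constants
  set c₂ : ℝ := roy_c2 ξ η with hc₂
  have hc1 : 1 ≤ c₂ := one_le_roy_c2 ξ η
  have hc0 : 0 < c₂ := by linarith
  have hpd0 : 0 ≤ pdist ξ η α := pdist_nonneg ξ η α
  have hpd1 : pdist ξ η α ≤ 1 := by
    refine hd.trans ?_
    rw [inv_le_comm₀ (by positivity) one_pos, inv_one]
    linarith
  have hα0' : 0 < ‖α 0‖ := lt_of_lt_of_le (by positivity) hα0
  have hα0ne : α 0 ≠ 0 := norm_pos_iff.mp hα0'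
  have hinvα : ‖α 0‖⁻¹ ≤ 2 * c₂ := by
    rw [inv_le_comm₀ hα0' (by positivity)]; exact hα0
  -- `δ₁`, `δ₂`
  set δ₁ : ℂ := α 1 / α 0 - ξ with hδ₁
  set δ₂ : ℂ := α 2 / α 0 - η * cexp δ₁ with hδ₂
  have hadist : adist ξ η α = ‖δ₂‖ := rfl
  have hδ₁eq : δ₁ = (α 1 - α 0 * ξ) / α 0 := by rw [hδ₁]; field_simp
  have hδ₁le : ‖δ₁‖ ≤ 2 * c₂ ^ 2 * pdist ξ η α := by
    rw [hδ₁eq, norm_div, div_eq_mul_inv]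
    calc ‖α 1 - α 0 * ξ‖ * ‖α 0‖⁻¹ ≤ (c₂ * pdist ξ η α) * (2 * c₂) :=
          mul_le_mul (norm_sub_xi_le_pdist ξ η α) hinvα (by positivity) (by positivity)
      _ = 2 * c₂ ^ 2 * pdist ξ η α := by ring
  have hδ₁c : ‖δ₁‖ ≤ c₂ := by
    refine hδ₁le.trans ?_
    calc 2 * c₂ ^ 2 * pdist ξ η α ≤ 2 * c₂ ^ 2 * (2 * c₂)⁻¹ :=
          mul_le_mul_of_nonneg_left hd (by positivity)
      _ = c₂ := by field_simp
  have hδ₂le : ‖δ₂‖ ≤ 2 * c₂ + c₂ * Real.exp c₂ := by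
    rw [hδ₂]
    refine (norm_sub_le _ _).trans (add_le_add ?_ ?_)
    · rw [norm_div, div_eq_mul_inv]
      calc ‖α 2‖ * ‖α 0‖⁻¹ ≤ 1 * (2 * c₂) :=
            mul_le_mul (hα 2) hinvα (by positivity) zero_le_one
        _ = 2 * c₂ := one_mul _
    · rw [norm_mul, Complex.norm_exp]
      refine mul_le_mul (norm_le_roy_c2_right ξ η) ?_ (by positivity) (by positivity)
      exact Real.exp_le_exp.mpr ((Complex.re_le_norm _).trans hδ₁c)
  -- the Taylor estimate for `f(z) = P(1, ξ+z, ηe^z)` at `δ₁`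
  have hTaylor : ‖expEvalH P ξ η δ₁‖ ≤ B * Real.exp (2 * c₂ ^ 2) +
      (c₂ ^ D * l1Norm P) * Real.exp (D * (2 * c₂ ^ 2)) * pdist ξ η α ^ T := by
    refine norm_le_of_iteratedDeriv_bounds (differentiable_expEvalH P ξ η) hB0
      (mul_nonneg (pow_nonneg hc0.le D) (l1Norm_nonneg P))
      (Nat.cast_nonneg D) (by positivity) hpd0 hpd1 (fun n hn => ?_) (fun n => ?_) hδ₁le
    · rw [iteratedDeriv_expEvalH_zero]; exact hB n hn
    · rw [iteratedDeriv_expEvalH_zero]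
      calc ‖aeval ![1, ξ, η] (homD^[n] P)‖ ≤ c₂ ^ D * (D : ℝ) ^ n * l1Norm P :=
            norm_aeval_iterate_homD_le hP ξ η n
        _ = c₂ ^ D * l1Norm P * (D : ℝ) ^ n := by ring
  -- homogeneity: `P(α₀, α₁, α₂ - δ₂α₀) = α₀^D f(δ₁)`
  set α' : Fin 3 → ℂ := ![α 0, α 1, α 2 - δ₂ * α 0] with hα'
  have hscale : α' = α 0 • (![1, ξ + δ₁, η * cexp δ₁] : Fin 3 → ℂ) := by
    ext i
    fin_cases i
    · simp [hα']
    · simp only [hα', Fin.mk_one, Matrix.cons_val_one, Matrix.cons_val_zero, Pi.smul_apply,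
        smul_eq_mul, hδ₁]
      field_simp
      ring
    · simp only [hα', Fin.reduceFinMk, Matrix.cons_val, Pi.smul_apply, smul_eq_mul, hδ₂]
      field_simp
      ring
  have hPα' : ‖aeval α' P‖ ≤ ‖expEvalH P ξ η δ₁‖ := by
    rw [hscale, aeval_smul_of_isHomogeneous hP, norm_mul, norm_pow]
    refine mul_le_of_le_one_left (norm_nonneg _) (pow_le_one₀ (norm_nonneg _) (hα 0))
  -- the Lipschitz step in the last coordinate
  set A : ℝ := roy_A ξ η with hA
  have hA1 : 1 ≤ A := by
    rw [hA, roy_A]; nlinarith [Real.exp_pos (roy_c2 ξ η)]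
  have hpert : ‖aeval α P - aeval α' P‖ ≤ l1Norm P * (D * A ^ D * ‖δ₂‖) := by
    refine norm_aeval_sub_aeval_le_l1Norm P hP.totalDegree_le α α' hA1 (norm_nonneg _)
      (fun i => (hα i).trans hA1) (fun i => ?_) (fun i => ?_)
    · fin_cases i
      · exact (hα 0).trans hA1
      · exact (hα 1).trans hA1
      · change ‖α 2 - δ₂ * α 0‖ ≤ A
        calc ‖α 2 - δ₂ * α 0‖ ≤ ‖α 2‖ + ‖δ₂‖ * ‖α 0‖ := by rw [← norm_mul]; exact norm_sub_le _ _
          _ ≤ 1 + (2 * c₂ + c₂ * Real.exp c₂) * 1 :=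
              add_le_add (hα 2) (mul_le_mul hδ₂le (hα 0) (norm_nonneg _) (by positivity))
          _ = A := by rw [hA, roy_A]; ring
    · fin_cases i
      · simp [hα']
      · simp [hα']
      · change ‖α 2 - (α 2 - δ₂ * α 0)‖ ≤ ‖δ₂‖
        rw [sub_sub_cancel, norm_mul]
        exact mul_le_of_le_one_right (norm_nonneg _) (hα 0)
  -- assembling
  have hmain : ‖aeval α P‖ ≤ ‖expEvalH P ξ η δ₁‖ + l1Norm P * (D * A ^ D * ‖δ₂‖) := by
    calc ‖aeval α P‖ = ‖aeval α' P + (aeval α P - aeval α' P)‖ := by rw [add_sub_cancel]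
      _ ≤ ‖aeval α' P‖ + ‖aeval α P - aeval α' P‖ := norm_add_le _ _
      _ ≤ ‖expEvalH P ξ η δ₁‖ + l1Norm P * (D * A ^ D * ‖δ₂‖) := add_le_add hPα' hpert
  -- comparison of the constants with `c₄^D`
  have hc4 : roy_c4 ξ η = c₂ * Real.exp (2 * c₂ ^ 2) + 2 * A := by rw [roy_c4, hA, hc₂]
  have hK1 : c₂ ^ D * Real.exp (D * (2 * c₂ ^ 2)) ≤ roy_c4 ξ η ^ D := by
    rw [Real.exp_nat_mul, ← mul_pow, hc4]
    exact pow_le_pow_left₀ (by positivity) (le_add_of_nonneg_right (by positivity)) D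
  have hK2 : (D : ℝ) * A ^ D ≤ roy_c4 ξ η ^ D := by
    have hD2 : (D : ℝ) ≤ 2 ^ D := by exact_mod_cast Nat.lt_two_pow_self.le
    calc (D : ℝ) * A ^ D ≤ 2 ^ D * A ^ D := mul_le_mul_of_nonneg_right hD2 (by positivity)
      _ = (2 * A) ^ D := (mul_pow _ _ _).symm
      _ ≤ roy_c4 ξ η ^ D := by
          rw [hc4]
          exact pow_le_pow_left₀ (by positivity) (le_add_of_nonneg_left (by positivity)) D
  have hl0 : 0 ≤ l1Norm P := l1Norm_nonneg _
  have hT0 : 0 ≤ pdist ξ η α ^ T := pow_nonneg hpd0 T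
  calc ‖aeval α P‖ ≤ ‖expEvalH P ξ η δ₁‖ + l1Norm P * (D * A ^ D * ‖δ₂‖) := hmain
    _ ≤ (B * Real.exp (2 * c₂ ^ 2) +
          (c₂ ^ D * l1Norm P) * Real.exp (D * (2 * c₂ ^ 2)) * pdist ξ η α ^ T) +
          l1Norm P * (D * A ^ D * ‖δ₂‖) := by linarith
    _ = Real.exp (2 * c₂ ^ 2) * B +
          l1Norm P * ((c₂ ^ D * Real.exp (D * (2 * c₂ ^ 2))) * pdist ξ η α ^ T +
            (D * A ^ D) * ‖δ₂‖) := by ring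
    _ ≤ Real.exp (2 * c₂ ^ 2) * B +
          l1Norm P * (roy_c4 ξ η ^ D * pdist ξ η α ^ T + roy_c4 ξ η ^ D * ‖δ₂‖) := by
        gcongr
    _ = Real.exp (2 * c₂ ^ 2) * B +
          l1Norm P * roy_c4 ξ η ^ D * (pdist ξ η α ^ T + adist ξ η α) := by rw [hadist]; ring

/-! ### Corollary 4.3 -/

/-- `c₄ > 0`. [folklore] -/
theorem roy_c4_pos (ξ η : ℂ) : 0 < roy_c4 ξ η := by
  have := one_le_roy_c2 ξ η
  rw [roy_c4, roy_A]; positivity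

/-- **Roy 2013, Corollary 4.3** (tested on an element): for `P ∈ I_D^{(γ,T)}` (`P ∈ ℂ[X]_D`,
`P ∈ vanIdeal ξ η T`) and `α` as in Lemma 4.1,
`|P(α)| ≤ ‖P‖ (3c₄)^D (dist(α,(1:γ))^T + dist(α, A_γ))`; in Roy's notation
`|I_D^{(γ,T)}|_α ≤ c₄^D (dist(α,(1:γ))^T + dist(α, A_γ))`. [cite: Roy2013, Corollary 4.3] -/
theorem cor_4_3 {ξ η : ℂ} {D T : ℕ} {P : CX} (hP : P.IsHomogeneous D) (hPv : P ∈ vanIdeal ξ η T)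
    {α : Fin 3 → ℂ} (hα : ∀ i, ‖α i‖ ≤ 1) (hα0 : (2 * roy_c2 ξ η)⁻¹ ≤ ‖α 0‖)
    (hd : pdist ξ η α ≤ (2 * roy_c2 ξ η)⁻¹) :
    ‖aeval α P‖ ≤ maxNorm P * (3 * roy_c4 ξ η) ^ D * (pdist ξ η α ^ T + adist ξ η α) := by
  have h := prop_4_2 (T := T) hP hα hα0 hd le_rfl (fun n hn => by rw [hPv n hn, norm_zero])
  rw [mul_zero, zero_add] at h
  refine h.trans ?_
  have hsum : 0 ≤ pdist ξ η α ^ T + adist ξ η α :=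
    add_nonneg (pow_nonneg (pdist_nonneg _ _ _) _) (adist_nonneg _ _ _)
  have hl : l1Norm P ≤ 3 ^ D * maxNorm P :=
    (l1Norm_le_card_mul_maxNorm P).trans (mul_le_mul_of_nonneg_right
      (by exact_mod_cast card_support_le_pow_of_isHomogeneous hP) (maxNorm_nonneg _))
  calc l1Norm P * roy_c4 ξ η ^ D * (pdist ξ η α ^ T + adist ξ η α)
      ≤ (3 ^ D * maxNorm P) * roy_c4 ξ η ^ D * (pdist ξ η α ^ T + adist ξ η α) := by
        have := pow_nonneg (roy_c4_pos ξ η).le D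
        gcongr
    _ = maxNorm P * (3 * roy_c4 ξ η) ^ D * (pdist ξ η α ^ T + adist ξ η α) := by
        rw [mul_pow]; ring

end Roy2013

end Literature.NumberTheory.Transcendental
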